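import Literature.Topology.FourManifolds.ProductComplex
import HarnessLib

/-!
# Expansion order of the product complex: the staircase simplices as elementary expansions

The explicit **expansion order** (a simplicial collapse read backwards) of the product complex
`K × [t 0, t N]` (`ProductComplex.lean`) from the base
`K × {t 0} ∪ Sub × [t 0, t N]` (`baseFaces`; in the engulfing theorem `L × 0 ∪ (L ∩ L₁) × I`):
slabs in increasing order, within a slab the prisms over the simplices `σ ∉ Sub` by increasing
dimension, and within the prism over `σ = [v₀, …, v_k]` the staircase simplices
`R_0, R_1, …, R_k` (`stair`), each entering through the **elementary expansion** across `R_i`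
from its *upper free face* `R_i ∖ {(v_i, t a)}` (apex `(v_i, t a)`).  For the family
`prevFaces a D σ i` of faces present before the step `(a, σ, i)` (`D` = the same-dimensional
simplices already done) we prove:

* `prevFaces_subset_productFaces`, `prevFaces_down_closed` — it is a subcomplex;
* `stair_notMem_prevFaces`, `erase_bot_notMem_prevFaces` — `R_i` and its upper free face are
  new (levels, projections `image_fst_stair = σ`, and `(v_i, t (a+1)) ∉ R_{i'}` for `i' < i`);
* `erase_mem_prevFaces` — **the horn is present**: every other facet of `R_i` lies in the
  prism over a proper face of `σ` (`prismFaces_filter_iff`), or is the upper free face of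
  `R_{i-1}` (`stair_succ_erase_top`), or the bottom simplex (`stair_zero_erase_top`; base or
  top of the previous slab);
* `prevFaces_succ` — **completeness**: after the step exactly `R_i` and its free face have
  been added (`eq_of_subset_stair_of_image_eq`: a subset of `R_i` projecting onto `σ` is `R_i`
  or one of its two `v_i`-faces);
* `prismFaces_subset_prevFaces_length`, `prevFaces_zero` — bookkeeping between prisms.

This is the cell-by-cell order of Rushing's inductive hypotheses `IH(k, m, a)` (proof of
Thm. 4.12.1), refined to single simplices so that each step is one elementary expansion to
which the cone-shadow stretch (`ConeShadow.lean`) applies.  Everything is proved; `baseFaces`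
and `prevFaces` are explicit; no named facts.

## References

* T. B. Rushing, *Topological Embeddings*, Academic Press (1973), §1.6.B (collapsing) and the
  proof of Thm. 4.12.1 (the sets `X(k, m, a)`). [Rushing1973]
* C. P. Rourke, B. J. Sanderson, *Introduction to Piecewise-Linear Topology*, Springer (1972),
  Ch. 3 (elementary collapses, `σ × I ↘ σ × 0 ∪ ∂σ × I`). [RourkeSanderson1972]
-/

open Set Function

noncomputable section

namespace Literature.Topology.FourManifolds

open Literature.Analysis.Convexity

/-! ## Expansion order: the staircase simplices as elementary expansions -/

section StairComb

variable {W : Type*} [DecidableEq W] {t₀ t₁ : ℝ}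

/-- The top copy of the first vertex lies in every staircase simplex. [folklore] -/
theorem liftV_head_mem_stair (v : W) (rest : List W) (i : ℕ) :
    liftV t₁ v ∈ stair t₀ t₁ (v :: rest) i := by
  rcases i with _ | j
  · rw [stair_cons_zero]; exact Finset.mem_insert_self _ _
  · rw [stair_cons_succ]; exact Finset.mem_insert_self _ _

/-- **The staircase simplices project onto the whole vertex list.** [folklore] -/
theorem image_fst_stair : ∀ (l : List W) (i : ℕ), i < l.length →
    (stair t₀ t₁ l i).image Prod.fst = l.toFinset
  | [], i, hi => by simp at hi
  | v :: rest, 0, _ => by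
      rw [stair_cons_zero, Finset.image_insert, liftV_fst]
      ext w
      simp [bottomSimplex, liftV]
  | v :: rest, j + 1, hj => by
      rw [stair_cons_succ, Finset.image_insert, liftV_fst, List.toFinset_cons,
        image_fst_stair rest j (by simpa using hj)]

/-- The bottom copy of `v` is in the first staircase simplex of `v :: rest` but the bottom copies
in later ones come from `rest`. [folklore] -/
theorem mem_stair_cons_succ_iff {v : W} {rest : List W} {j : ℕ} {q : W × ℝ} :
    q ∈ stair t₀ t₁ (v :: rest) (j + 1) ↔ q = liftV t₁ v ∨ q ∈ stair t₀ t₁ rest j := by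
  rw [stair_cons_succ, Finset.mem_insert]

/-- **Full subsets of a staircase simplex.** A subset of `R_i` projecting onto all the vertices
is `R_i`, its upper free face `R_i ∖ {(v_i, t₀)}`, or its lower face `R_i ∖ {(v_i, t₁)}`.
[folklore] -/
theorem eq_of_subset_stair_of_image_eq (ht : t₀ ≠ t₁) : ∀ (l : List W) (_ : l.Nodup) (i : ℕ)
    (hi : i < l.length) (F : Finset (W × ℝ)), F ⊆ stair t₀ t₁ l i → F.image Prod.fst = l.toFinset →
      F = stair t₀ t₁ l i ∨ F = (stair t₀ t₁ l i).erase (liftV t₀ l[i]) ∨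
        F = (stair t₀ t₁ l i).erase (liftV t₁ l[i])
  | [], _, i, hi, _, _, _ => by simp at hi
  | v :: rest, hnd, 0, _, F, hF, hπ => by
      have hv : v ∉ rest := (List.nodup_cons.1 hnd).1
      -- all bottom copies over `rest` are in `F`
      have hbots : ∀ w ∈ rest, liftV t₀ w ∈ F := fun w hw => by
        have hwπ : w ∈ F.image Prod.fst := by rw [hπ]; simp [hw]
        obtain ⟨q, hq, hqw⟩ := Finset.mem_image.1 hwπ
        have hq' := hF hq
        rw [stair_cons_zero, Finset.mem_insert] at hq'
        rcases hq' with h | h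
        · rw [h, liftV_fst] at hqw; exact absurd (hqw ▸ hw) hv
        · obtain ⟨w', hw', rfl⟩ := mem_bottomSimplex.1 h
          rw [liftV_fst] at hqw; subst hqw; exact hq
      have hvF : liftV t₁ v ∈ F ∨ liftV t₀ v ∈ F := by
        have hvπ : v ∈ F.image Prod.fst := by rw [hπ]; simp
        obtain ⟨q, hq, hqv⟩ := Finset.mem_image.1 hvπ
        have hq' := hF hq
        rw [stair_cons_zero, Finset.mem_insert] at hq'
        rcases hq' with h | h
        · exact Or.inl (h ▸ hq)
        · obtain ⟨w', hw', rfl⟩ := mem_bottomSimplex.1 h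
          rw [liftV_fst] at hqv; subst hqv; exact Or.inr hq
      -- compare with the three candidates
      have hget : (v :: rest)[0] = v := rfl
      simp only [hget]
      have hS : stair t₀ t₁ (v :: rest) 0 = insert (liftV t₁ v) (insert (liftV t₀ v) (bottomSimplex t₀ rest)) := by
        rw [stair_cons_zero, bottomSimplex, bottomSimplex, List.map_cons, List.toFinset_cons]
      have hne01 : liftV t₁ v ≠ liftV t₀ v := liftV_ne_liftV ht.symm v v
      have htop_nb : liftV t₁ v ∉ bottomSimplex t₀ rest := fun h => ht (snd_eq_of_mem_bottomSimplex h).symm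
      have hbot_nb : liftV t₀ v ∉ bottomSimplex t₀ rest := fun h => by
        obtain ⟨w, hw, hwv⟩ := mem_bottomSimplex.1 h
        exact hv ((liftV_injective t₀ hwv) ▸ hw)
      have hBsub : bottomSimplex t₀ rest ⊆ F := fun q hq => by
        obtain ⟨w, hw, rfl⟩ := mem_bottomSimplex.1 hq; exact hbots w hw
      have hFsub : F ⊆ insert (liftV t₁ v) (insert (liftV t₀ v) (bottomSimplex t₀ rest)) := hS ▸ hF
      by_cases h1 : liftV t₁ v ∈ F <;> by_cases h0 : liftV t₀ v ∈ F
      · left; rw [hS]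
        refine Finset.Subset.antisymm hFsub ?_
        exact Finset.insert_subset h1 (Finset.insert_subset h0 hBsub)
      · right; left; rw [hS, Finset.erase_insert_of_ne hne01, Finset.erase_insert hbot_nb]
        refine Finset.Subset.antisymm (fun q hq => ?_) (Finset.insert_subset h1 hBsub)
        rcases Finset.mem_insert.1 (hFsub hq) with h | h
        · exact Finset.mem_insert.2 (Or.inl h)
        · rcases Finset.mem_insert.1 h with h' | h'
          · exact absurd (h' ▸ hq) h0
          · exact Finset.mem_insert_of_mem h'
      · right; right; rw [hS, Finset.erase_insert (by
          rw [Finset.mem_insert, not_or]; exact ⟨hne01, htop_nb⟩)]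
        refine Finset.Subset.antisymm (fun q hq => ?_) (Finset.insert_subset h0 hBsub)
        rcases Finset.mem_insert.1 (hFsub hq) with h | h
        · exact absurd (h ▸ hq) h1
        · exact h
      · exfalso; rcases hvF with h | h
        · exact h1 h
        · exact h0 h
  | v :: rest, hnd, j + 1, hj, F, hF, hπ => by
      have hv : v ∉ rest := (List.nodup_cons.1 hnd).1
      have hj' : j < rest.length := by simpa using hj
      -- the top copy of `v` is in `F`
      have htopF : liftV t₁ v ∈ F := by
        have hvπ : v ∈ F.image Prod.fst := by rw [hπ]; simp
        obtain ⟨q, hq, hqv⟩ := Finset.mem_image.1 hvπ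
        rcases mem_stair_cons_succ_iff.1 (hF hq) with h | h
        · exact h ▸ hq
        · obtain ⟨w, hw, h' | h'⟩ := exists_of_mem_stair h
          all_goals rw [h', liftV_fst] at hqv; exact absurd (hqv ▸ hw) hv
      set F' := F.erase (liftV t₁ v) with hF'
      have hF's : F' ⊆ stair t₀ t₁ rest j := fun q hq => by
        have hq' := Finset.mem_erase.1 hq
        exact (mem_stair_cons_succ_iff.1 (hF hq'.2)).resolve_left hq'.1
      have htop_ns : liftV t₁ v ∉ stair t₀ t₁ rest j := fun h => by
        obtain ⟨w, hw, h' | h'⟩ := exists_of_mem_stair h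
        · exact ht.symm (congrArg Prod.snd h')
        · exact hv ((liftV_injective t₁ h') ▸ hw)
      have hπ' : F'.image Prod.fst = rest.toFinset := by
        apply Finset.Subset.antisymm
        · exact (Finset.image_subset_image hF's).trans (by rw [image_fst_stair rest j hj'])
        · intro w hw
          have hw' : w ∈ rest := List.mem_toFinset.1 hw
          have hwπ : w ∈ F.image Prod.fst := by rw [hπ]; simp [hw']
          obtain ⟨q, hq, hqw⟩ := Finset.mem_image.1 hwπ
          refine Finset.mem_image.2 ⟨q, Finset.mem_erase.2 ⟨fun h => hv ?_, hq⟩, hqw⟩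
          rw [h, liftV_fst] at hqw; rwa [hqw]
      have IH := eq_of_subset_stair_of_image_eq ht rest (List.nodup_cons.1 hnd).2 j hj' F' hF's hπ'
      have hFeq : F = insert (liftV t₁ v) F' := (Finset.insert_erase htopF).symm
      have hget : (v :: rest)[j + 1] = rest[j] := rfl
      simp only [hget]
      have hne_t : ∀ s : ℝ, liftV t₁ v ≠ liftV s rest[j] := fun s h =>
        hv (by have := congrArg Prod.fst h; simp [liftV] at this; rw [this]; exact List.getElem_mem hj')
      rw [hFeq, stair_cons_succ, Finset.erase_insert_of_ne (hne_t t₀), Finset.erase_insert_of_ne (hne_t t₁)]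
      rcases IH with h | h | h
      · left; rw [h]
      · right; left; rw [h]
      · right; right; rw [h]


/-- The lower face of the first staircase simplex is the bottom simplex. [folklore] -/
theorem stair_zero_erase_top (ht : t₀ ≠ t₁) (v : W) (rest : List W) :
    (stair t₀ t₁ (v :: rest) 0).erase (liftV t₁ v) = bottomSimplex t₀ (v :: rest) := by
  rw [stair_cons_zero, Finset.erase_insert]
  exact fun h => ht (snd_eq_of_mem_bottomSimplex h).symm

/-- Bottom copies of a vertex not in the list are not in its staircase simplices. [folklore] -/
theorem liftV_notMem_stair_of_notMem {v : W} {l : List W} (hv : v ∉ l) (s : ℝ) (i : ℕ) :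
    liftV s v ∉ stair t₀ t₁ l i := fun h => by
  obtain ⟨w, hw, h' | h'⟩ := exists_of_mem_stair h
  all_goals
    have := congrArg Prod.fst h'
    simp only [liftV_fst] at this
    exact hv (this ▸ hw)

/-- **The lower face of `R_{i+1}` is the upper free face of `R_i`.** [folklore] -/
theorem stair_succ_erase_top (ht : t₀ ≠ t₁) : ∀ (l : List W) (_ : l.Nodup) (i : ℕ)
    (hi : i + 1 < l.length),
    (stair t₀ t₁ l (i + 1)).erase (liftV t₁ l[i + 1]) = (stair t₀ t₁ l i).erase (liftV t₀ l[i])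
  | [], _, i, hi => by simp at hi
  | [v], _, i, hi => by simp at hi
  | v :: w :: rest, hnd, 0, _ => by
      have hv : v ∉ w :: rest := (List.nodup_cons.1 hnd).1
      have hget1 : (v :: w :: rest)[1] = w := rfl
      have hget0 : (v :: w :: rest)[0] = v := rfl
      simp only [hget1, hget0]
      have hbv : liftV t₀ v ∉ bottomSimplex t₀ (w :: rest) := fun h => by
        obtain ⟨w', hw', hwv⟩ := mem_bottomSimplex.1 h
        exact hv ((liftV_injective t₀ hwv) ▸ hw')
      have htw : liftV t₁ v ≠ liftV t₁ w := fun h => hv (by rw [liftV_injective t₁ h]; simp)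
      calc (stair t₀ t₁ (v :: w :: rest) (0 + 1)).erase (liftV t₁ w)
          = insert (liftV t₁ v) ((stair t₀ t₁ (w :: rest) 0).erase (liftV t₁ w)) := by
            rw [stair_cons_succ, Finset.erase_insert_of_ne htw]
        _ = insert (liftV t₁ v) (bottomSimplex t₀ (w :: rest)) := by rw [stair_zero_erase_top ht]
        _ = (stair t₀ t₁ (v :: w :: rest) 0).erase (liftV t₀ v) := by
            rw [stair_cons_zero, Finset.erase_insert_of_ne (liftV_ne_liftV ht.symm v v)]
            congr 1
            rw [show bottomSimplex t₀ (v :: w :: rest) = insert (liftV t₀ v) (bottomSimplex t₀ (w :: rest))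
              from by simp [bottomSimplex], Finset.erase_insert hbv]
  | v :: w :: rest, hnd, j + 1, hj => by
      have hv : v ∉ w :: rest := (List.nodup_cons.1 hnd).1
      have hj' : j + 1 < (w :: rest).length := by simpa using hj
      have IH := stair_succ_erase_top ht (w :: rest) (List.nodup_cons.1 hnd).2 j hj'
      have hget2 : (v :: w :: rest)[j + 1 + 1] = (w :: rest)[j + 1] := rfl
      have hget1 : (v :: w :: rest)[j + 1] = (w :: rest)[j] := rfl
      simp only [hget2, hget1]
      have hne : ∀ (s : ℝ) (u : W), u ∈ w :: rest → liftV t₁ v ≠ liftV s u := fun s u hu h =>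
        hv (by have := congrArg Prod.fst h; simp [liftV] at this; rwa [this])
      rw [stair_cons_succ v (w :: rest) (j + 1), stair_cons_succ v (w :: rest) j,
        Finset.erase_insert_of_ne (hne t₁ _ (List.getElem_mem hj')),
        Finset.erase_insert_of_ne (hne t₀ _ (List.getElem_mem (Nat.lt_of_succ_lt hj'))), IH]


/-- The top copy of `v_i` lies in `R_i`. [folklore] -/
theorem liftV_top_getElem_mem_stair : ∀ (l : List W) (i : ℕ) (hi : i < l.length),
    liftV t₁ l[i] ∈ stair t₀ t₁ l i
  | [], i, hi => by simp at hi
  | v :: rest, 0, _ => by rw [stair_cons_zero]; exact Finset.mem_insert_self _ _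
  | v :: rest, j + 1, hj => by
      rw [stair_cons_succ]
      exact Finset.mem_insert_of_mem (liftV_top_getElem_mem_stair rest j (by simpa using hj))

/-- The bottom copy of `v_i` lies in `R_i`. [folklore] -/
theorem liftV_bot_getElem_mem_stair : ∀ (l : List W) (i : ℕ) (hi : i < l.length),
    liftV t₀ l[i] ∈ stair t₀ t₁ l i
  | [], i, hi => by simp at hi
  | v :: rest, 0, _ => by
      rw [stair_cons_zero]
      exact Finset.mem_insert_of_mem (mem_bottomSimplex.2 ⟨v, List.mem_cons_self, rfl⟩)
  | v :: rest, j + 1, hj => by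
      rw [stair_cons_succ]
      exact Finset.mem_insert_of_mem (liftV_bot_getElem_mem_stair rest j (by simpa using hj))

/-- The top copy of `v_i` is not in the earlier staircase simplices. [folklore] -/
theorem liftV_top_getElem_notMem_stair (ht : t₀ ≠ t₁) : ∀ (l : List W) (_ : l.Nodup) (i' i : ℕ)
    (_ : i' < i) (hi : i < l.length), liftV t₁ l[i] ∉ stair t₀ t₁ l i'
  | [], _, i', i, _, hi => by simp at hi
  | v :: rest, hnd, 0, i, hlt, hi => by
      obtain ⟨j, rfl⟩ := Nat.exists_eq_succ_of_ne_zero (Nat.pos_iff_ne_zero.1 hlt)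
      have hv : v ∉ rest := (List.nodup_cons.1 hnd).1
      have hj : j < rest.length := by simpa using hi
      have hget : (v :: rest)[j + 1] = rest[j] := rfl
      rw [hget, stair_cons_zero, Finset.mem_insert, not_or]
      refine ⟨fun h => hv ?_, fun h => ht (snd_eq_of_mem_bottomSimplex h).symm⟩
      rw [← liftV_injective t₁ h]; exact List.getElem_mem hj
  | v :: rest, hnd, j' + 1, i, hlt, hi => by
      obtain ⟨j, rfl⟩ := Nat.exists_eq_succ_of_ne_zero (by omega : i ≠ 0)
      have hv : v ∉ rest := (List.nodup_cons.1 hnd).1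
      have hj : j < rest.length := by simpa using hi
      have hget : (v :: rest)[j + 1] = rest[j] := rfl
      rw [hget, stair_cons_succ, Finset.mem_insert, not_or]
      refine ⟨fun h => hv ?_, liftV_top_getElem_notMem_stair ht rest (List.nodup_cons.1 hnd).2 j' j
        (by omega) hj⟩
      rw [← liftV_injective t₁ h]; exact List.getElem_mem hj

/-- The staircase simplices of a nonempty list are nonempty with at least two vertices: they
contain the top copy of the first vertex and the bottom copy of the last. [folklore] -/
theorem two_le_card_stair (ht : t₀ ≠ t₁) : ∀ (l : List W) (i : ℕ), i < l.length →
    2 ≤ (stair t₀ t₁ l i).card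
  | [], i, hi => by simp at hi
  | v :: rest, i, hi => by
      have h1 : liftV t₁ v ∈ stair t₀ t₁ (v :: rest) i := liftV_head_mem_stair v rest i
      obtain ⟨u, hu⟩ : ∃ u, liftV t₀ u ∈ stair t₀ t₁ (v :: rest) i := by
        rcases i with _ | j
        · refine ⟨v, ?_⟩
          rw [stair_cons_zero]
          exact Finset.mem_insert_of_mem (mem_bottomSimplex.2 ⟨v, List.mem_cons_self, rfl⟩)
        · have hj : j < rest.length := by simpa using hi
          refine ⟨rest[j], ?_⟩
          rw [stair_cons_succ]
          exact Finset.mem_insert_of_mem (liftV_bot_getElem_mem_stair rest j hj)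
      have hne : liftV t₁ v ≠ liftV t₀ u := liftV_ne_liftV ht.symm v u
      calc 2 = ({liftV t₁ v, liftV t₀ u} : Finset (W × ℝ)).card := (Finset.card_pair hne).symm
        _ ≤ _ := Finset.card_le_card (by
          rw [Finset.insert_subset_iff, Finset.singleton_subset_iff]; exact ⟨h1, hu⟩)

end StairComb




section Expansion

variable {W : Type*} [NormedAddCommGroup W] [NormedSpace ℝ W] [DecidableEq W]
variable {K : Geometry.SimplicialComplex ℝ W} {L : List W} {t : ℕ → ℝ} {N : ℕ} {Sub : Set (Finset W)}

/-- **The base of the expansion**: the bottom copy `K × {t 0}` and the full product over the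
subcomplex `Sub` (in the engulfing theorem: `L × 0 ∪ (L ∩ L₁) × I`). [folklore] -/
def baseFaces (K : Geometry.SimplicialComplex ℝ W) (L : List W) (t : ℕ → ℝ) (N : ℕ)
    (Sub : Set (Finset W)) : Set (Finset (W × ℝ)) :=
  {F | ∃ τ ∈ K.faces, F.Nonempty ∧ F ⊆ bottomSimplex (t 0) (faceList L τ)} ∪
    {F | ∃ a, a < N ∧ ∃ τ ∈ Sub, F ∈ prismFaces (t a) (t (a + 1)) (faceList L τ)}

/-- **The faces present before the expansion step `(a, σ, i)`** (slab `a`, prism over `σ`,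
staircase simplex `R_i`), the prisms over the same-dimensional simplices in `D` being already
done: the base, all lower slabs, the prisms of slab `a` over smaller simplices and over `D`, and
the earlier staircase simplices of this prism. [folklore] -/
def prevFaces (K : Geometry.SimplicialComplex ℝ W) (L : List W) (t : ℕ → ℝ) (N : ℕ)
    (Sub : Set (Finset W)) (a : ℕ) (D : Set (Finset W)) (σ : Finset W) (i : ℕ) :
    Set (Finset (W × ℝ)) :=
  baseFaces K L t N Sub ∪
    {F | ∃ a', a' < a ∧ ∃ τ ∈ K.faces, F ∈ prismFaces (t a') (t (a' + 1)) (faceList L τ)} ∪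
    {F | ∃ τ ∈ K.faces, τ.card < σ.card ∧ F ∈ prismFaces (t a) (t (a + 1)) (faceList L τ)} ∪
    {F | ∃ τ ∈ D, F ∈ prismFaces (t a) (t (a + 1)) (faceList L τ)} ∪
    {F | F.Nonempty ∧ ∃ i', i' < i ∧ F ⊆ stair (t a) (t (a + 1)) (faceList L σ) i'}

omit [NormedAddCommGroup W] [NormedSpace ℝ W] in
/-- Prism faces are down-closed. [folklore] -/
theorem prismFaces_down_closed {t₀ t₁ : ℝ} {l : List W} {F G : Finset (W × ℝ)}
    (hF : F ∈ prismFaces t₀ t₁ l) (hGF : G ⊆ F) (hG : G.Nonempty) : G ∈ prismFaces t₀ t₁ l := by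
  obtain ⟨-, i, hi, hFi⟩ := hF
  exact ⟨hG, i, hi, hGF.trans hFi⟩

omit [NormedAddCommGroup W] [NormedSpace ℝ W] in
/-- Bottom faces are prism faces. [folklore] -/
theorem mem_prismFaces_of_subset_bottomSimplex {t₀ t₁ : ℝ} {l : List W} {F : Finset (W × ℝ)}
    (hF : F ⊆ bottomSimplex t₀ l) (hne : F.Nonempty) : F ∈ prismFaces t₀ t₁ l := by
  obtain ⟨q, hq⟩ := hne
  obtain ⟨w, hw, -⟩ := mem_bottomSimplex.1 (hF hq)
  obtain ⟨v, rest, rfl⟩ := List.exists_cons_of_ne_nil (List.ne_nil_of_mem hw)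
  refine ⟨⟨q, hq⟩, 0, by simp, ?_⟩
  rw [stair_cons_zero]
  exact hF.trans (Finset.subset_insert _ _)

omit [NormedAddCommGroup W] [NormedSpace ℝ W] in
/-- The top simplex of a prism is a prism face. [folklore] -/
theorem mem_prismFaces_of_subset_topSimplex {t₀ t₁ : ℝ} {l : List W} {F : Finset (W × ℝ)}
    (hF : F ⊆ bottomSimplex t₁ l) (hne : F.Nonempty) : F ∈ prismFaces t₀ t₁ l := by
  obtain ⟨q, hq⟩ := hne
  obtain ⟨w, hw, -⟩ := mem_bottomSimplex.1 (hF hq)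
  have hlen : 0 < l.length := List.length_pos_of_mem hw
  refine ⟨⟨q, hq⟩, l.length - 1, Nat.sub_lt hlen one_pos, fun p hp => ?_⟩
  obtain ⟨u, hu, rfl⟩ := mem_bottomSimplex.1 (hF hp)
  have hlen' : l.length - 1 + 1 = l.length := Nat.sub_add_cancel hlen
  rw [stair, hlen', List.take_length]
  exact Finset.mem_union_left _ (List.mem_toFinset.2 (List.mem_map.2 ⟨u, hu, rfl⟩))

/-- **(C1a)** The previous faces are faces of the product complex. [folklore] -/
theorem prevFaces_subset_productFaces (hSub : Sub ⊆ K.faces) {a : ℕ} (ha : a < N) {D : Set (Finset W)}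
    (hD : D ⊆ K.faces) {σ : Finset W} (hσ : σ ∈ K.faces) {i : ℕ} (hi : i ≤ (faceList L σ).length) :
    prevFaces K L t N Sub a D σ i ⊆ productFaces K L t N := by
  have hN : 0 < N := lt_of_le_of_lt (Nat.zero_le a) ha
  rintro F ((((hF | hF) | hF) | hF) | hF)
  · rcases hF with ⟨τ, hτ, hne, hFτ⟩ | ⟨a', ha', τ, hτ, hFτ⟩
    · exact mem_productFaces_iff.2 ⟨0, hN, τ, hτ, mem_prismFaces_of_subset_bottomSimplex hFτ hne⟩
    · exact mem_productFaces_iff.2 ⟨a', ha', τ, hSub hτ, hFτ⟩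
  · obtain ⟨a', ha', τ, hτ, hFτ⟩ := hF
    exact mem_productFaces_iff.2 ⟨a', ha'.trans ha, τ, hτ, hFτ⟩
  · obtain ⟨τ, hτ, -, hFτ⟩ := hF
    exact mem_productFaces_iff.2 ⟨a, ha, τ, hτ, hFτ⟩
  · obtain ⟨τ, hτ, hFτ⟩ := hF
    exact mem_productFaces_iff.2 ⟨a, ha, τ, hD hτ, hFτ⟩
  · obtain ⟨hne, i', hi', hFi⟩ := hF
    exact mem_productFaces_iff.2 ⟨a, ha, σ, hσ, hne, i', lt_of_lt_of_le hi' hi, hFi⟩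

/-- **(C1b)** The previous faces are down-closed. [folklore] -/
theorem prevFaces_down_closed {a : ℕ} {D : Set (Finset W)} {σ : Finset W} {i : ℕ}
    {F G : Finset (W × ℝ)} (hF : F ∈ prevFaces K L t N Sub a D σ i) (hGF : G ⊆ F) (hG : G.Nonempty) :
    G ∈ prevFaces K L t N Sub a D σ i := by
  rcases hF with ((((hF | hF) | hF) | hF) | hF)
  · rcases hF with ⟨τ, hτ, -, hFτ⟩ | ⟨a', ha', τ, hτ, hFτ⟩
    · exact Or.inl (Or.inl (Or.inl (Or.inl (Or.inl ⟨τ, hτ, hG, hGF.trans hFτ⟩))))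
    · exact Or.inl (Or.inl (Or.inl (Or.inl (Or.inr ⟨a', ha', τ, hτ, prismFaces_down_closed hFτ hGF hG⟩))))
  · obtain ⟨a', ha', τ, hτ, hFτ⟩ := hF
    exact Or.inl (Or.inl (Or.inl (Or.inr ⟨a', ha', τ, hτ, prismFaces_down_closed hFτ hGF hG⟩)))
  · obtain ⟨τ, hτ, hc, hFτ⟩ := hF
    exact Or.inl (Or.inl (Or.inr ⟨τ, hτ, hc, prismFaces_down_closed hFτ hGF hG⟩))
  · obtain ⟨τ, hτ, hFτ⟩ := hF
    exact Or.inl (Or.inr ⟨τ, hτ, prismFaces_down_closed hFτ hGF hG⟩)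
  · obtain ⟨-, i', hi', hFi⟩ := hF
    exact Or.inr ⟨hG, i', hi', hGF.trans hFi⟩


/-! ### The expansion step `(a, σ, i)`: newness, horn, completeness -/

section Step

variable (hL : L.Nodup) (hKL : ∀ σ ∈ K.faces, σ ⊆ L.toFinset) (ht : StrictMono t)
variable {a : ℕ} {D : Set (Finset W)} {σ : Finset W} (hσ : σ ∈ K.faces) {i : ℕ}

include hKL hσ in
/-- The staircase simplices of the prism over `σ` project onto `σ`. [folklore] -/
theorem image_fst_stair_faceList (hi : i < (faceList L σ).length) :
    (stair (t a) (t (a + 1)) (faceList L σ) i).image Prod.fst = σ := by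
  rw [image_fst_stair _ i hi, faceList_toFinset (hKL σ hσ)]

include hKL hσ in
/-- **Faces of `R_i` not projecting onto `σ` are already present** (in the prism over a smaller
simplex). [folklore] -/
theorem mem_prevFaces_of_image_ne (hi : i < (faceList L σ).length) {F : Finset (W × ℝ)}
    (hF : F ⊆ stair (t a) (t (a + 1)) (faceList L σ) i) (hne : F.Nonempty) (hπ : F.image Prod.fst ≠ σ) :
    F ∈ prevFaces K L t N Sub a D σ i := by
  set τ := F.image Prod.fst with hτ
  have hτσ : τ ⊆ σ := (Finset.image_subset_image hF).trans (by rw [image_fst_stair_faceList hKL hσ hi])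
  have hτne : τ.Nonempty := hne.image _
  have hτK : τ ∈ K.faces := K.down_closed hσ hτσ hτne
  have hcard : τ.card < σ.card := Finset.card_lt_card (Finset.ssubset_iff_subset_ne.2 ⟨hτσ, hπ⟩)
  refine Or.inl (Or.inl (Or.inr ⟨τ, hτK, hcard, ?_⟩))
  rw [← faceList_filter hτσ, prismFaces_filter_iff]
  exact ⟨⟨hne, i, hi, hF⟩, fun q hq => Finset.mem_image_of_mem _ hq⟩

include hL ht hσ in
/-- **The lower face of `R_i` is already present.** [folklore] -/
theorem erase_top_mem_prevFaces (hi : i < (faceList L σ).length) :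
    (stair (t a) (t (a + 1)) (faceList L σ) i).erase (liftV (t (a + 1)) (faceList L σ)[i]) ∈
      prevFaces K L t N Sub a D σ i := by
  have htne : t a ≠ t (a + 1) := (ht (Nat.lt_succ_self a)).ne
  rcases i with _ | j
  · -- the bottom simplex: base (slab 0) or top of the previous slab
    obtain ⟨v, rest, hl⟩ := List.exists_cons_of_ne_nil (List.ne_nil_of_length_pos hi)
    have hget : (faceList L σ)[0] = v := by simp [hl]
    rw [hget]
    have heq : (stair (t a) (t (a + 1)) (faceList L σ) 0).erase (liftV (t (a + 1)) v) =
        bottomSimplex (t a) (faceList L σ) := by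
      rw [hl]; exact stair_zero_erase_top htne v rest
    rw [heq]
    have hbne : (bottomSimplex (t a) (faceList L σ)).Nonempty :=
      ⟨liftV (t a) v, mem_bottomSimplex.2 ⟨v, by rw [hl]; exact List.mem_cons_self, rfl⟩⟩
    rcases a with _ | a'
    · exact Or.inl (Or.inl (Or.inl (Or.inl (Or.inl ⟨σ, hσ, hbne, Finset.Subset.rfl⟩))))
    · refine Or.inl (Or.inl (Or.inl (Or.inr ⟨a', Nat.lt_succ_self a', σ, hσ, ?_⟩)))
      exact mem_prismFaces_of_subset_topSimplex Finset.Subset.rfl hbne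
  · -- the upper free face of `R_j`
    have hj : j < (faceList L σ).length := Nat.lt_of_succ_lt hi
    rw [stair_succ_erase_top htne (faceList L σ) (faceList_nodup hL σ) j hi]
    refine Or.inr ⟨?_, j, Nat.lt_succ_self j, Finset.erase_subset _ _⟩
    -- nonempty: contains the top copy of `v_j`
    refine ⟨liftV (t (a + 1)) (faceList L σ)[j], Finset.mem_erase.2 ⟨?_, liftV_top_getElem_mem_stair _ j hj⟩⟩
    exact liftV_ne_liftV htne.symm _ _

include hL hKL ht hσ in
/-- **(C3) The horn of `R_i` is already present**: every facet other than the upper free face.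
[folklore] -/
theorem erase_mem_prevFaces (hi : i < (faceList L σ).length) {q : W × ℝ}
    (hq : q ∈ stair (t a) (t (a + 1)) (faceList L σ) i) (hqa : q ≠ liftV (t a) (faceList L σ)[i]) :
    (stair (t a) (t (a + 1)) (faceList L σ) i).erase q ∈ prevFaces K L t N Sub a D σ i := by
  have htne : t a ≠ t (a + 1) := (ht (Nat.lt_succ_self a)).ne
  set A := stair (t a) (t (a + 1)) (faceList L σ) i with hA
  have hGne : (A.erase q).Nonempty := by
    rw [← Finset.card_pos, Finset.card_erase_of_mem hq]
    have h2 : 2 ≤ A.card := two_le_card_stair htne (faceList L σ) i hi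
    omega
  by_cases hπ : (A.erase q).image Prod.fst = σ
  · have hπ' : (A.erase q).image Prod.fst = (faceList L σ).toFinset := by
      rw [hπ, faceList_toFinset (hKL σ hσ)]
    rcases eq_of_subset_stair_of_image_eq htne (faceList L σ) (faceList_nodup hL σ) i hi (A.erase q)
      (Finset.erase_subset _ _) hπ' with h | h | h
    · exact absurd h (Finset.erase_ne_self.2 hq)  -- `A.erase q ≠ A`
    · exact absurd (Finset.erase_injOn A hq (liftV_bot_getElem_mem_stair _ i hi) h) hqa
    · rw [h]; exact erase_top_mem_prevFaces hL ht hσ hi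
  · exact mem_prevFaces_of_image_ne hKL hσ hi (Finset.erase_subset _ _) hGne hπ


variable (hSub : Sub ⊆ K.faces) (hSubdown : ∀ τ ∈ Sub, ∀ ρ ∈ K.faces, ρ ⊆ τ → ρ ∈ Sub) (hσS : σ ∉ Sub)
  (hD : ∀ τ ∈ D, τ ∈ K.faces ∧ τ.card = σ.card ∧ τ ≠ σ)

include hL hKL ht hσ hSub hSubdown hσS hD in
/-- **(C2) engine**: a set of vertices of `R_i` projecting onto `σ` and containing the top copy
of `v_i` is not yet present. [folklore] -/
theorem notMem_prevFaces_of_image_eq (hi : i < (faceList L σ).length) {G : Finset (W × ℝ)}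
    (hπ : G.image Prod.fst = σ) (htop : liftV (t (a + 1)) (faceList L σ)[i] ∈ G) :
    G ∉ prevFaces K L t N Sub a D σ i := by
  have htne : t a ≠ t (a + 1) := (ht (Nat.lt_succ_self a)).ne
  -- the projection of a prism face lies in its base simplex
  have hproj : ∀ {a' : ℕ} {τ : Finset W}, τ ∈ K.faces →
      G ∈ prismFaces (t a') (t (a' + 1)) (faceList L τ) → σ ⊆ τ := fun {a'} {τ} hτ hG => by
    rw [← hπ, ← faceList_toFinset (hKL τ hτ)]
    exact image_fst_subset_of_mem_prismFaces hG
  rintro ((((hG | hG) | hG) | hG) | hG)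
  · rcases hG with ⟨τ, -, -, hGτ⟩ | ⟨a', -, τ, hτ, hGτ⟩
    · -- bottom faces live at level `t 0 < t (a+1)`
      have h0 := snd_eq_of_mem_bottomSimplex (hGτ htop)
      simp only [liftV_snd] at h0
      exact absurd (ht.injective h0) (Nat.succ_ne_zero a)
    · exact hσS (hSubdown τ hτ σ hσ (hproj (hSub hτ) hGτ))
  · obtain ⟨a', ha', τ, -, -, i', -, hGi⟩ := hG
    obtain ⟨w, -, h | h⟩ := exists_of_mem_stair (hGi htop)
    · have := ht.injective (congrArg Prod.snd h); omega
    · have := ht.injective (congrArg Prod.snd h); omega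
  · obtain ⟨τ, hτ, hcard, hGτ⟩ := hG
    exact absurd (Finset.card_le_card (hproj hτ hGτ)) (not_le.2 hcard)
  · obtain ⟨τ, hτD, hGτ⟩ := hG
    obtain ⟨hτK, hcard, hne⟩ := hD τ hτD
    exact hne (Finset.eq_of_subset_of_card_le (hproj hτK hGτ) hcard.le).symm
  · obtain ⟨-, i', hi', hGi⟩ := hG
    exact liftV_top_getElem_notMem_stair htne (faceList L σ) (faceList_nodup hL σ) i' i hi' hi (hGi htop)


include hL hKL ht hσ hSub hSubdown hσS hD in
/-- **(C2a) `R_i` is new.** [folklore] -/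
theorem stair_notMem_prevFaces (hi : i < (faceList L σ).length) :
    stair (t a) (t (a + 1)) (faceList L σ) i ∉ prevFaces K L t N Sub a D σ i :=
  notMem_prevFaces_of_image_eq hL hKL ht hσ hSub hSubdown hσS hD hi
    (image_fst_stair_faceList hKL hσ hi) (liftV_top_getElem_mem_stair _ i hi)

include hKL ht hσ in
/-- The upper free face of `R_i` projects onto `σ`. [folklore] -/
theorem image_fst_erase_bot (hi : i < (faceList L σ).length) :
    ((stair (t a) (t (a + 1)) (faceList L σ) i).erase (liftV (t a) (faceList L σ)[i])).image Prod.fst = σ := by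
  have htne : t a ≠ t (a + 1) := (ht (Nat.lt_succ_self a)).ne
  apply Finset.Subset.antisymm
  · exact (Finset.image_subset_image (Finset.erase_subset _ _)).trans
      (by rw [image_fst_stair_faceList hKL hσ hi])
  · intro w hw
    rw [← image_fst_stair_faceList hKL hσ hi (a := a)] at hw
    obtain ⟨q, hq, rfl⟩ := Finset.mem_image.1 hw
    by_cases hqb : q = liftV (t a) (faceList L σ)[i]
    · refine Finset.mem_image.2 ⟨liftV (t (a + 1)) (faceList L σ)[i], Finset.mem_erase.2
        ⟨liftV_ne_liftV htne.symm _ _, liftV_top_getElem_mem_stair _ i hi⟩, ?_⟩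
      rw [hqb]; rfl
    · exact Finset.mem_image.2 ⟨q, Finset.mem_erase.2 ⟨hqb, hq⟩, rfl⟩

include hL hKL ht hσ hSub hSubdown hσS hD in
/-- **(C2b) The upper free face of `R_i` is new.** [folklore] -/
theorem erase_bot_notMem_prevFaces (hi : i < (faceList L σ).length) :
    (stair (t a) (t (a + 1)) (faceList L σ) i).erase (liftV (t a) (faceList L σ)[i]) ∉
      prevFaces K L t N Sub a D σ i := by
  have htne : t a ≠ t (a + 1) := (ht (Nat.lt_succ_self a)).ne
  exact notMem_prevFaces_of_image_eq hL hKL ht hσ hSub hSubdown hσS hD hi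
    (image_fst_erase_bot hKL ht hσ hi) (Finset.mem_erase.2
      ⟨liftV_ne_liftV htne.symm _ _, liftV_top_getElem_mem_stair _ i hi⟩)

include hL hKL ht hσ in
/-- **(C4) Completeness of the step**: after the step exactly `R_i` and its upper free face have
been added. [folklore] -/
theorem prevFaces_succ (hi : i < (faceList L σ).length) :
    prevFaces K L t N Sub a D σ (i + 1) =
      insert (stair (t a) (t (a + 1)) (faceList L σ) i)
        (insert ((stair (t a) (t (a + 1)) (faceList L σ) i).erase (liftV (t a) (faceList L σ)[i]))
          (prevFaces K L t N Sub a D σ i)) := by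
  have htne : t a ≠ t (a + 1) := (ht (Nat.lt_succ_self a)).ne
  set A := stair (t a) (t (a + 1)) (faceList L σ) i with hA
  ext F
  constructor
  · rintro ((((hF | hF) | hF) | hF) | hF)
    · exact Set.mem_insert_of_mem _ (Set.mem_insert_of_mem _ (Or.inl (Or.inl (Or.inl (Or.inl hF)))))
    · exact Set.mem_insert_of_mem _ (Set.mem_insert_of_mem _ (Or.inl (Or.inl (Or.inl (Or.inr hF)))))
    · exact Set.mem_insert_of_mem _ (Set.mem_insert_of_mem _ (Or.inl (Or.inl (Or.inr hF))))
    · exact Set.mem_insert_of_mem _ (Set.mem_insert_of_mem _ (Or.inl (Or.inr hF)))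
    · obtain ⟨hne, i', hi', hFi⟩ := hF
      rcases (Nat.lt_succ_iff.1 hi').eq_or_lt with rfl | hlt
      · by_cases hπ : F.image Prod.fst = σ
        · have hπ' : F.image Prod.fst = (faceList L σ).toFinset := by
            rw [hπ, faceList_toFinset (hKL σ hσ)]
          rcases eq_of_subset_stair_of_image_eq htne (faceList L σ) (faceList_nodup hL σ) i' hi F hFi hπ'
            with h | h | h
          · exact h ▸ Set.mem_insert _ _
          · exact Set.mem_insert_of_mem _ (h ▸ Set.mem_insert _ _)
          · exact Set.mem_insert_of_mem _ (Set.mem_insert_of_mem _ (h ▸ erase_top_mem_prevFaces hL ht hσ hi))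
        · exact Set.mem_insert_of_mem _ (Set.mem_insert_of_mem _
            (mem_prevFaces_of_image_ne hKL hσ hi hFi hne hπ))
      · exact Set.mem_insert_of_mem _ (Set.mem_insert_of_mem _ (Or.inr ⟨hne, i', hlt, hFi⟩))
  · rintro (rfl | rfl | hF)
    · refine Or.inr ⟨?_, i, Nat.lt_succ_self i, Finset.Subset.rfl⟩
      rw [← Finset.card_pos]
      have h2 : 2 ≤ A.card := two_le_card_stair htne (faceList L σ) i hi
      omega
    · refine Or.inr ⟨?_, i, Nat.lt_succ_self i, Finset.erase_subset _ _⟩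
      exact ⟨liftV (t (a + 1)) (faceList L σ)[i], Finset.mem_erase.2
        ⟨liftV_ne_liftV htne.symm _ _, liftV_top_getElem_mem_stair _ i hi⟩⟩
    · rcases hF with ((((hF | hF) | hF) | hF) | hF)
      · exact Or.inl (Or.inl (Or.inl (Or.inl hF)))
      · exact Or.inl (Or.inl (Or.inl (Or.inr hF)))
      · exact Or.inl (Or.inl (Or.inr hF))
      · exact Or.inl (Or.inr hF)
      · obtain ⟨hne, i', hi', hFi⟩ := hF
        exact Or.inr ⟨hne, i', Nat.lt_succ_of_lt hi', hFi⟩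

/-- **(C5) End of a prism**: after the last staircase simplex all faces of the prism over `σ`
are present. [folklore] -/
theorem prismFaces_subset_prevFaces_length :
    prismFaces (t a) (t (a + 1)) (faceList L σ) ⊆ prevFaces K L t N Sub a D σ (faceList L σ).length :=
  fun _ ⟨hne, i, hi, hFi⟩ => Or.inr ⟨hne, i, hi, hFi⟩

/-- **(C5') Start of a prism**: before the first staircase simplex the previous faces are the
base, the lower slabs and the smaller and done prisms only. [folklore] -/
theorem prevFaces_zero :
    prevFaces K L t N Sub a D σ 0 =
      baseFaces K L t N Sub ∪
        {F | ∃ a', a' < a ∧ ∃ τ ∈ K.faces, F ∈ prismFaces (t a') (t (a' + 1)) (faceList L τ)} ∪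
        {F | ∃ τ ∈ K.faces, τ.card < σ.card ∧ F ∈ prismFaces (t a) (t (a + 1)) (faceList L τ)} ∪
        {F | ∃ τ ∈ D, F ∈ prismFaces (t a) (t (a + 1)) (faceList L τ)} := by
  ext F
  simp only [prevFaces, Set.mem_union, Set.mem_setOf_eq, Nat.not_lt_zero, false_and, exists_false,
    and_false, or_false]

end Step



end Expansion


end Literature.Topology.FourManifolds
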